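import Summits.ValiantsHypothesis.ValiantsHypothesis.Theorems.DepthWindowGenFlatRank
import Summits.ValiantsHypothesis.ValiantsHypothesis.Theorems.DepthWindowBDSLaw
import Literature.Computability.AlgebraicComplexity.GenWordRank
import HarnessLib

/-!
# Route `DepthWindow` — the Bhargav–Dutta–Saxena bound for HOMOGENEOUS circuits at fixed parameters

Helper file of the route `Theses/DepthWindow.lean` (decomp-valiant workshop, lens 4, generation 10; port plan `PLAN-w2`
F4′).  It assembles the BDS column of the slope–rate dial from the pieces landed before it:
the continued-fraction parameter bundle `exists_params` (`DepthWindowBDSLaw.lean`: thresholds `b_m`, the law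
`D c_m ≤ 2 b_m |(2a-D) q - a p|` for `2D ≤ b_{m+1}`, the step `λ q b_m ≤ 8 b_{m+2} c_m`, the bottom seam
`λ q ≤ 4 b_1 (q-p)`), the general word machinery `Literature/…/GenWord*.lean` (two-letter greedy word with letters
`+(q-p)t`, `-qt`: `overLen ≤ qt`, `P_w` a block projection of `IMM_{n,d}`, `relrk(P_w) ≥ 2^{-qt/2}`), and the
law-driven flat rank induction `Law.relRank_eval_le_law` (`DepthWindowGenFlatRank.lean`) run with
`θ_0 = 3/2`, `θ_{m+1} = b_{m+1}/2`, `κ_0 = (q-p)t`, `κ_{m+1} = t c_m/(2 b_m)`, `ε = 2^{-qtλ/64}`.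

* `law_level_zero`, `law_level_succ` : the imbalance law of the BDS word below `θ_0` and below `θ_{m+1}`;
* `step_level_zero`, `step_level_succ` : `2^{-κ_p θ_{p+1}/2} ≤ ε` from the bottom seam and from the step;
* `homBds` : over any field, for a circuit of product-depth `≤ Δ` (`Δ ≥ 1`) all of whose gate values are homogeneous,
  computing `IMM_{n,d}`, with `32 ≤ λ`, `λ^{F_{Δ+2}} ≤ λ d` and `4 d ≤ ⌊log₂ n⌋ =: L`:
  `2^{L (λ - 32)/128} ≤ (s d^d + 1)^Δ`.

With `λ ≈ d^{1/(F_{Δ+2}-1)}` this is `s ≥ n^{Ω(d^{1/(F_{Δ+2}-1)}/Δ)}/d^d` — the golden-ratio exponent of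
[BhargavDuttaSaxena2024, Thm 1.4 / Lemma 4.3] for homogeneous circuits; `DepthWindowBDSFit.fit` supplies the
parameters in the `HomImmHardAt 7 5` regime.  Unconditional, 0 sorry, def-free; rung currency only — nothing here
bears on `VP ≠ VNP` itself.

References: [BhargavDuttaSaxena2024] §4.1, Lemma 4.1, Claim 4.2, Lemma 4.3; [LimayeSrinivasanTavenas2025] Claim 16, Lemma 15.
-/

-- layout Summits/ValiantsHypothesis/ValiantsHypothesis forces the duplicated namespace component
set_option linter.dupNamespace false

namespace Summit.ValiantsHypothesis.ValiantsHypothesis.Theorems.DepthWindow.BDS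

open MvPolynomial Literature.Computability.AlgebraicComplexity ArithCircuit
open Literature.Computability.AlgebraicComplexity.GenWord
open Summit.ValiantsHypothesis.ValiantsHypothesis.Theorems.DepthWindow.Law

noncomputable section

universe u

/-- **The law below `θ_0 = 3/2`**: a block set with fewer than `3/2` blocks is empty or a single block, whose
weight is `(q-p)t` or `-qt`; so `#W · kp ≤ |w_W|` when `kp ≤ kn`. [cite: BhargavDuttaSaxena2024, §4.1] -/
theorem law_level_zero {d : ℕ} (kp kn : ℕ) (hk : kp ≤ kn) (w : Fin d → Bool) (W : Finset (Fin d))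
    (hW : (W.card : ℝ) < 3 / 2) :
    (W.card : ℝ) * kp ≤ |((wsum (letterSize₂ kp kn w) w W : ℤ) : ℝ)| := by
  have hW1 : W.card ≤ 1 := by
    by_contra h
    have h2 : (2 : ℝ) ≤ W.card := by exact_mod_cast (show 2 ≤ W.card by omega)
    linarith
  rcases Nat.lt_or_ge W.card 1 with h0 | h1
  · have : W.card = 0 := by omega
    rw [this, Nat.cast_zero, zero_mul]
    exact abs_nonneg _
  · obtain ⟨i, hi⟩ := Finset.card_eq_one.1 (le_antisymm hW1 h1)
    subst hi
    rw [Finset.card_singleton, Nat.cast_one, one_mul]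
    unfold wsum wt letterSize₂
    rw [Finset.sum_singleton]
    cases w i
    · simp only [Bool.false_eq_true, if_false, Int.cast_neg, Int.cast_natCast, abs_neg, Nat.abs_cast]
      exact_mod_cast hk
    · simp only [if_true, Int.cast_natCast, Nat.abs_cast, le_refl]

/-- **The law below `θ_{m+1} = b_{m+1}/2`** for the word with letters `+(q-p)t`, `-qt`: a block set `W` with `a`
positive and `D - a` negative blocks has `w_W = t((2a-D)q - ap)`, and the continued-fraction law
`D c_m ≤ 2 b_m |(2a-D)q - ap|` (`2D ≤ b_{m+1}`) gives `#W · (t c_m/(2 b_m)) ≤ |w_W|`.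
[cite: BhargavDuttaSaxena2024, Lemma 4.3] -/
theorem law_level_succ {d p q bm bm1 cm : ℕ} (t : ℕ) (hpq : p ≤ q) (hbm : 1 ≤ bm)
    (hlaw : ∀ a D : ℕ, a ≤ D → 2 * D ≤ bm1 → (D : ℤ) * cm ≤ 2 * bm * |((2 * a : ℤ) - D) * q - a * p|)
    (w : Fin d → Bool) (W : Finset (Fin d)) (hW : (W.card : ℝ) < (bm1 : ℝ) / 2) :
    (W.card : ℝ) * (((t * cm : ℕ) : ℝ) / (2 * bm)) ≤
      |((wsum (letterSize₂ ((q - p) * t) (q * t) w) w W : ℤ) : ℝ)| := by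
  classical
  set a := (W.filter fun i => w i).card with ha
  set a' := (W.filter fun i => !w i).card with ha'
  have hfilt : (W.filter fun i => !w i) = W.filter (fun i => ¬ (w i = true)) :=
    Finset.filter_congr (fun i _ => by simp)
  have hsum : a + a' = W.card := by
    rw [ha, ha', hfilt]
    exact Finset.card_filter_add_card_filter_not _
  have haD : a ≤ W.card := by omega
  have h2D : 2 * W.card ≤ bm1 := by
    have h1 : (2 * W.card : ℝ) < bm1 := by linarith
    have h2 : 2 * W.card < bm1 := by exact_mod_cast h1
    omega
  have hl := hlaw a W.card haD h2D
  have hlR : ((W.card : ℤ) * cm : ℝ) ≤ ((2 * bm * |((2 * a : ℤ) - W.card) * q - a * p| : ℤ) : ℝ) := by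
    exact_mod_cast hl
  push_cast at hlR
  have hws : ((wsum (letterSize₂ ((q - p) * t) (q * t) w) w W : ℤ) : ℝ) =
      (t : ℝ) * (((2 * a : ℝ) - W.card) * q - a * p) := by
    rw [wsum_letterSize₂, ← ha, ← ha']
    have ha'R : (a' : ℝ) = W.card - a := by
      have : ((a + a' : ℕ) : ℝ) = W.card := by rw [hsum]
      push_cast at this
      linarith
    push_cast [Nat.cast_sub hpq]
    rw [ha'R]
    ring
  have hbm0 : (0 : ℝ) < bm := by exact_mod_cast hbm
  have ht0 : (0 : ℝ) ≤ t := Nat.cast_nonneg _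
  rw [hws, abs_mul, abs_of_nonneg ht0]
  calc (W.card : ℝ) * (((t * cm : ℕ) : ℝ) / (2 * bm))
      = (t : ℝ) / (2 * bm) * ((W.card : ℝ) * cm) := by push_cast; ring
    _ ≤ (t : ℝ) / (2 * bm) * (2 * bm * |((2 * a : ℝ) - W.card) * q - a * p|) :=
        mul_le_mul_of_nonneg_left hlR (by positivity)
    _ = (t : ℝ) * |((2 * a : ℝ) - W.card) * q - a * p| := by
        field_simp

/-- **The bottom step** `2^{-κ_0 θ_1/2} ≤ ε`: with `κ_0 = (q-p)t`, `θ_1 = λ/2` and the bottom seam `λq ≤ 4λ(q-p)`,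
`(q-p)tλ/4 ≥ qtλ/64`. [cite: BhargavDuttaSaxena2024, §4.1] -/
theorem step_level_zero {p q lam : ℕ} (t : ℕ) (hlam : 1 ≤ lam) (hpq : p ≤ q)
    (hbot : lam * q ≤ 4 * lam * (q - p)) :
    (2 : ℝ) ^ (-(((q - p) * t : ℕ) : ℝ) * ((lam : ℝ) / 2) / 2) ≤
      (2 : ℝ) ^ (-((q * t : ℕ) : ℝ) * lam / 64) := by
  refine Real.rpow_le_rpow_of_exponent_le (by norm_num) ?_
  have h1 : q ≤ 4 * (q - p) := by
    have h : lam * q ≤ lam * (4 * (q - p)) := by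
      calc lam * q ≤ 4 * lam * (q - p) := hbot
        _ = lam * (4 * (q - p)) := by ring
    exact Nat.le_of_mul_le_mul_left h (by omega)
  have h1R : (q : ℝ) ≤ 4 * ((q : ℝ) - p) := by
    have : (q : ℝ) ≤ 4 * ((q - p : ℕ) : ℝ) := by exact_mod_cast h1
    rwa [Nat.cast_sub hpq] at this
  have hpqR : (p : ℝ) ≤ q := by exact_mod_cast hpq
  push_cast [Nat.cast_sub hpq]
  have htl : (0 : ℝ) ≤ (t : ℝ) * lam := by positivity
  have h2 : (q : ℝ) * ((t : ℝ) * lam) ≤ 16 * ((q : ℝ) - p) * ((t : ℝ) * lam) := by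
    have := mul_le_mul_of_nonneg_right h1R htl
    nlinarith
  nlinarith

/-- **The step** `2^{-κ_{m+1} θ_{m+2}/2} ≤ ε`: with `κ_{m+1} = t c_m/(2 b_m)`, `θ_{m+2} = b_{m+2}/2` and
`λ q b_m ≤ 8 b_{m+2} c_m`, `t c_m b_{m+2}/(8 b_m) ≥ qtλ/64`. [cite: BhargavDuttaSaxena2024, Lemma 4.3] -/
theorem step_level_succ {q lam bm bm2 cm : ℕ} (t : ℕ) (hbm : 1 ≤ bm) (hstep : lam * q * bm ≤ 8 * bm2 * cm) :
    (2 : ℝ) ^ (-(((t * cm : ℕ) : ℝ) / (2 * bm)) * ((bm2 : ℝ) / 2) / 2) ≤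
      (2 : ℝ) ^ (-((q * t : ℕ) : ℝ) * lam / 64) := by
  refine Real.rpow_le_rpow_of_exponent_le (by norm_num) ?_
  have hR : (lam : ℝ) * q * bm ≤ 8 * bm2 * cm := by exact_mod_cast hstep
  have hbm0 : (0 : ℝ) < bm := by exact_mod_cast hbm
  have ht0 : (0 : ℝ) ≤ t := Nat.cast_nonneg _
  push_cast
  rw [show -(((t : ℝ) * cm) / (2 * bm)) * ((bm2 : ℝ) / 2) / 2 = -((t : ℝ) * cm * bm2 / (8 * bm)) by ring,
    show -((q : ℝ) * t) * lam / 64 = -((q : ℝ) * t * lam / 64) by ring, neg_le_neg_iff,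
    le_div_iff₀ (by positivity),
    show (q : ℝ) * t * lam / 64 * (8 * bm) = ((lam : ℝ) * q * bm * t) / 8 by ring,
    div_le_iff₀ (by norm_num)]
  have := mul_le_mul_of_nonneg_right hR ht0
  linarith

/-- **BDS for homogeneous circuits at fixed parameters**: over any field, a circuit of product-depth `≤ Δ` (`1 ≤ Δ`)
all of whose gate values are homogeneous, computing `IMM_{n,d}`, with `32 ≤ λ`, `λ^{F_{Δ+2}} ≤ λ·d` and
`4 d ≤ ⌊log₂ n⌋ = L`, satisfies `2^{L(λ-32)/128} ≤ (s d^d + 1)^Δ`.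
[cite: BhargavDuttaSaxena2024, Lemma 4.3] -/
theorem homBds (K : Type u) [Field K] {Δ : ℕ} (hΔ : 1 ≤ Δ) (n d lam : ℕ) (hd1 : 1 ≤ d) (hlam : 32 ≤ lam)
    (hfit : lam ^ Nat.fib (Δ + 2) ≤ lam * d) (hdn : 4 * d ≤ Nat.log 2 n)
    (C : ArithCircuit K (Fin d × Fin n × Fin n)) (hCΔ : C.productDepth ≤ Δ)
    (hhom : ∀ v ∈ ArithCircuit.gateValues C.gates, ∃ e : ℕ, v.IsHomogeneous e)
    (hC : C.Computes (immPoly n d K)) :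
    (2 : ℝ) ^ ((Nat.log 2 n : ℝ) * ((lam : ℝ) - 32) / 128) ≤ ((C.size * d ^ d + 1 : ℕ) : ℝ) ^ Δ := by
  obtain ⟨Δ, rfl⟩ : ∃ Δ', Δ = Δ' + 1 := ⟨Δ - 1, by omega⟩
  set L := Nat.log 2 n with hL
  have hL1 : 4 ≤ L := le_trans (by omega) hdn
  have hn0 : n ≠ 0 := by
    rintro rfl
    rw [Nat.log_zero_right] at hL
    omega
  have h2L : 2 ^ L ≤ n := Nat.pow_log_le_self 2 hn0
  -- the continued-fraction parameters
  obtain ⟨p, q, b, c, hb0, hb1, hbmono, hbpow, hp1, hlp, -, hq2b, -, hlaw, hstep, hbot⟩ :=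
    exists_params lam Δ (by omega)
  have hlam0 : 0 < lam := by omega
  have hbΔ : b (Δ + 1) ≤ d := Nat.le_of_mul_le_mul_left ((hbpow (Δ + 1)).trans hfit) hlam0
  have hpq : p ≤ q := le_trans (Nat.le_mul_of_pos_left p hlam0) hlp
  have hq1 : 1 ≤ q := hp1.trans hpq
  have hqL : q ≤ L := by omega
  have hbge : ∀ m, 1 ≤ b m := fun m => hb0 ▸ hbmono (Nat.zero_le m)
  rw [hb1] at hbot
  -- `t = ⌊L/q⌋`, `k = qt ∈ [L/2, L]`
  set t := L / q with ht
  have hkL : q * t ≤ L := by rw [ht, mul_comm]; exact Nat.div_mul_le_self L q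
  have hkL2 : L ≤ 2 * (q * t) := by
    have h1 : L < q * (L / q + 1) := Nat.lt_mul_div_succ L (show 0 < q by omega)
    rw [mul_add, mul_one, ← ht] at h1
    omega
  -- the two-letter greedy word `+(q-p)t / -qt` and the word substitution
  set kp := (q - p) * t with hkp
  set kn := q * t with hkn
  have hkpn : kp ≤ kn := Nat.mul_le_mul_right t (Nat.sub_le q p)
  set w := greedyWord₂ d kp kn with hw
  set sz := letterSize₂ kp kn w with hsz
  have hover : ∀ t', overLen sz w t' ≤ kn := fun t' => by
    have h := overLen_greedy_le d kp kn t'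
    rw [max_eq_right hkpn] at h
    exact h
  have hn' : ∀ t', t' ≤ d → 2 ^ overLen sz w t' ≤ n := fun t' _ =>
    (Nat.pow_le_pow_right Nat.two_pos ((hover t').trans hkL)).trans h2L
  have hg := isBlockPreserving_wordSubst sz w K hn'
  have heval : aeval (wordSubst sz w K hn') C.eval = wordPoly sz w K := by
    rw [show C.eval = immPoly n d K from hC]
    exact aeval_wordSubst_immPoly sz w K hn' hd1
  have hrig := rigid_of_gateValues_gen hg hhom (Δ + 1)
  -- the engine with `θ_0 = 3/2`, `θ_{m+1} = b_{m+1}/2`, `κ_0 = kp`, `κ_{m+1} = t c_m/(2 b_m)`, `ε = 2^{-kn λ/64}`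
  have hε0 : (0 : ℝ) < (2 : ℝ) ^ (-(kn : ℝ) * lam / 64) := Real.rpow_pos_of_pos (by norm_num) _
  have hup := relRank_eval_le_law (P := C) hg hε0 hd1 (Δ := Δ + 1)
    (θ := fun i => if i = 0 then 3 / 2 else (b i : ℝ) / 2)
    (κ := fun i => if i = 0 then (kp : ℝ) else ((t * c (i - 1) : ℕ) : ℝ) / (2 * b (i - 1)))
    (fun i => by
      rcases i with _ | m
      · rw [if_pos rfl]; norm_num
      · rw [if_neg (Nat.succ_ne_zero m)]
        have h1 : lam ≤ b (m + 1) := hb1 ▸ hbmono (show 1 ≤ m + 1 by omega)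
        have h2 : (32 : ℝ) ≤ b (m + 1) := by exact_mod_cast hlam.trans h1
        linarith)
    (fun i hi W hW => by
      rcases i with _ | m
      · rw [if_pos rfl] at hW ⊢
        exact law_level_zero kp kn hkpn w W hW
      · rw [if_neg (Nat.succ_ne_zero m)] at hW ⊢
        simp only [Nat.add_sub_cancel]
        exact law_level_succ t hpq (hbge m) (hlaw m (by omega)) w W hW)
    (fun i hi => by split_ifs <;> positivity)
    (fun i hi => by
      rcases i with _ | m
      · rw [if_pos rfl, if_neg (Nat.succ_ne_zero 0), hb1]
        exact step_level_zero t (by omega) hpq hbot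
      · rw [if_neg (Nat.succ_ne_zero m), if_neg (Nat.succ_ne_zero (m + 1))]
        simp only [Nat.add_sub_cancel]
        exact step_level_succ t (hbge m) (hstep m (by omega)))
    hrig hCΔ
    (by
      rw [if_neg (Nat.succ_ne_zero Δ)]
      have : (b (Δ + 1) : ℝ) ≤ d := by exact_mod_cast hbΔ
      linarith)
  rw [heval] at hup
  have h := (relRank_wordPoly_ge sz w K (hover d)).trans hup
  -- solve for the size
  have h2 : (0 : ℝ) < 2 := by norm_num
  have hmul := mul_le_mul_of_nonneg_right h (Real.rpow_nonneg h2.le ((kn : ℝ) * lam / 64))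
  rw [mul_assoc, ← Real.rpow_add h2, ← Real.rpow_add h2] at hmul
  have e1 : -(kn : ℝ) / 2 + (kn : ℝ) * lam / 64 = (kn : ℝ) * ((lam : ℝ) - 32) / 64 := by ring
  have e2 : -(kn : ℝ) * lam / 64 + (kn : ℝ) * lam / 64 = 0 := by ring
  rw [e1, e2, Real.rpow_zero, mul_one] at hmul
  refine le_trans (Real.rpow_le_rpow_of_exponent_le one_le_two ?_) hmul
  have hknR : (L : ℝ) ≤ 2 * kn := by exact_mod_cast hkL2
  have hl32 : (0 : ℝ) ≤ (lam : ℝ) - 32 := by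
    have : (32 : ℝ) ≤ lam := by exact_mod_cast hlam
    linarith
  nlinarith [mul_le_mul_of_nonneg_right hknR hl32]

end

end Summit.ValiantsHypothesis.ValiantsHypothesis.Theorems.DepthWindow.BDS
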